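import Summits.NavierStokesRegularity.NavierStokesRegularity.Theorems.CoriolisHeadCounterRotatingLiouvilleHeadGrowth
import HarnessLib

/-!
# Route CoriolisHead · crux `NoCoRotatingCore` (stmt-NavierStokesRegularity-22676) —
# polynomial growth of the mean-square gradient of a bounded rotated profile

Support file (`--supports stmt-NavierStokesRegularity-22676`; theorems only, no definitions, no named
facts).  For a smooth BOUNDED solution `(U, P)` of the rotated Leray profile system
`−νΔU + aU + a DU[y] + (BU − DU[By]) + DU[U] + ∇P = 0`, `div U = 0` (`ν, a > 0`, `B` skew):

* `exists_integral_ball_frobeniusNormSq_fderiv_le_of_rotated` — **mean-square gradient growth**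
  `∫_{B(0,R)} |DU|² ≤ K (1 + R)^m` for all `R ≥ 1` (here `m = N + 4`): Tsai's local gradient estimate
  (3.1) for rotated profiles (`exists_gradient_estimate_consts_of_rotated`, in tree) on `B(0, R)`
  with `|U| ≤ M`, the polynomial pressure growth `|P| ≤ C'(1 + |y|)^N` of a bounded rotated profile
  (`exists_pressure_growth_of_rotated`, in tree), and `vol B̄(0, 2R) = (2R)³ vol B̄(0, 1)`;
* `sq_sum_clm_apply_le` — the pointwise bound `(Σₗ (B (L eₗ))ₗ)² ≤ 3 ‖B‖² |L|²` for the Coriolis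
  defect `tr(B∘L)`, so that the SPIN VORTICITY `ω_β = −tr(B∘DU)` inherits the mean-square growth
  (`exists_integral_ball_sq_spinVorticity_le_of_rotated`).

This is the (only) growth input of the Gaussian-weighted energy Liouville theorem
(`CoriolisHeadNoCoRotatingCoreEnergyLiouville`) used by the no-axial-velocity rung of the crux
(`CoriolisHeadNoCoRotatingCoreNoAxialVelocity`).  POINTWISE growth of `DU` is not needed and not proved.

HONEST FRAMING.  Nothing here proves `NoCoRotatingCore`, bounded rotated-profile Liouville, or
Navier–Stokes regularity.

References: T.-P. Tsai, ARMA 143 (1998) 29–51, Lemma 3.1 (3.1) and Lemma 3.2 [Tsai1998];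
B. Pineau, V. Vicol, arXiv:2607.09619, (1.8) [PineauVicol2026].
-/

noncomputable section

-- the summit and its single sub-problem share the name (CONVENTIONS §1), as in every Theorems file
set_option linter.dupNamespace false

open MeasureTheory Set Function Filter Topology InnerProductSpace Metric
open scoped RealInnerProductSpace Laplacian ContDiff BigOperators ENNReal NNReal
open Literature.Analysis.FluidPDE

namespace Summit.NavierStokesRegularity.NavierStokesRegularity.Theorems.CoriolisHead

section MeanSquare

-- nested operator types `ℝ³ →L[ℝ] ℝ³ →L[ℝ] ℝ³`
set_option maxSynthPendingDepth 3

variable {ν a : ℝ} {B : EuclideanSpace ℝ (Fin 3) →L[ℝ] EuclideanSpace ℝ (Fin 3)}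
  {U : EuclideanSpace ℝ (Fin 3) → EuclideanSpace ℝ (Fin 3)} {P : EuclideanSpace ℝ (Fin 3) → ℝ}

/-- A bounded integrand on a closed ball: `∫_{B̄(0,r)} g ≤ c · r³ · vol B̄(0,1)` when `|g| ≤ c` on
`B̄(0, r)` (`r ≥ 0`). [folklore] -/
theorem setIntegral_closedBall_le_of_abs_le {g : EuclideanSpace ℝ (Fin 3) → ℝ} {c r : ℝ}
    (hr : 0 ≤ r) (hg : ∀ x ∈ closedBall (0 : EuclideanSpace ℝ (Fin 3)) r, |g x| ≤ c) :
    ∫ x in closedBall (0 : EuclideanSpace ℝ (Fin 3)) r, g x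
      ≤ c * (r ^ 3 * (volume (closedBall (0 : EuclideanSpace ℝ (Fin 3)) 1)).toReal) := by
  have hfin : volume (closedBall (0 : EuclideanSpace ℝ (Fin 3)) r) < ⊤ := measure_closedBall_lt_top
  have h := norm_setIntegral_le_of_norm_le_const hfin (f := g)
    (fun x hx => by rw [Real.norm_eq_abs]; exact hg x hx)
  have hvol : volume.real (closedBall (0 : EuclideanSpace ℝ (Fin 3)) r)
      = r ^ 3 * (volume (closedBall (0 : EuclideanSpace ℝ (Fin 3)) 1)).toReal := by
    rw [measureReal_def, Measure.addHaar_closedBall' volume (0 : EuclideanSpace ℝ (Fin 3)) hr,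
      finrank_euclideanSpace_fin, ENNReal.toReal_mul, ENNReal.toReal_ofReal (by positivity)]
  rw [hvol, Real.norm_eq_abs] at h
  exact (le_abs_self _).trans h

/-- **Mean-square gradient growth of a bounded rotated profile**: for a smooth bounded solution of
the rotated Leray profile system (`ν, a > 0`, `B` skew) there are `K` and `m` with
`∫_{B(0,R)} |DU|² ≤ K (1 + R)^m` for every `R ≥ 1` (Tsai's (3.1) on `B(0,R)` with `|U| ≤ M` and
`|P| ≤ C'(1 + |y|)^N`). [cite: Tsai1998, Lemma 3.1 (3.1) (p. 37)] -/
theorem exists_integral_ball_frobeniusNormSq_fderiv_le_of_rotated (hν : 0 < ν) (ha : 0 < a)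
    (hU : ContDiff ℝ (⊤ : ℕ∞) U) (hP : ContDiff ℝ 2 P) (hB : ∀ x, ⟪B x, x⟫ = 0)
    (hdiv : VectorCalculus.IsDivFree U)
    (heq : ∀ y, -(ν • (Δ U) y) + a • U y + a • fderiv ℝ U y y + (B (U y) - fderiv ℝ U y (B y)) +
      convect U U y + gradient P y = 0)
    (hbdd : ∃ M : ℝ, ∀ y, ‖U y‖ ≤ M) :
    ∃ (K : ℝ) (m : ℕ), ∀ R : ℝ, 1 ≤ R →
      ∫ x in ball (0 : EuclideanSpace ℝ (Fin 3)) R, frobeniusNormSq (fderiv ℝ U x) ≤ K * (1 + R) ^ m := by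
  obtain ⟨M, hM⟩ := hbdd
  have hM0 : 0 ≤ M := (norm_nonneg _).trans (hM 0)
  -- polynomial pressure growth of a bounded rotated profile (in tree)
  obtain ⟨N, C, R₀, hPR⟩ := exists_pressure_growth_of_rotated hU hP hB hdiv heq hν ha.le hM
  obtain ⟨C', hC'0, hC'⟩ := exists_poly_bound_of_eventually_le hP.continuous hPR
  -- Tsai's (3.1) for rotated profiles (in tree)
  obtain ⟨C₁, C₂, hC₁0, hC₂0, hgrad⟩ := exists_gradient_estimate_consts_of_rotated
  set V₁ : ℝ := (volume (closedBall (0 : EuclideanSpace ℝ (Fin 3)) 1)).toReal with hV₁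
  have hV₁0 : 0 ≤ V₁ := ENNReal.toReal_nonneg
  set A : ℝ := ν * C₂ / 2 + a / 2 + (a + ‖B‖) * C₁ with hA
  have hA0 : 0 ≤ A := by positivity
  refine ⟨8 * V₁ / ν * (A * M ^ 2 + C₁ * M ^ 3 + C₁ * (C' * 2 ^ N * M)), N + 3, fun R hR => ?_⟩
  have hR0 : 0 < R := by linarith
  have h31 := hgrad hU hP hB hdiv heq hν.le ha.le hR0 (0 : EuclideanSpace ℝ (Fin 3)) 0
  simp only [norm_zero, zero_add, sub_zero] at h31
  set t : ℝ := 1 + R with ht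
  have ht1 : 1 ≤ t := by linarith
  have hRt : R ≤ t := by linarith
  have h2R : 0 ≤ 2 * R := by positivity
  -- the three local integrals over `B̄(0, 2R)`
  have hJ2 : ∫ x in closedBall (0 : EuclideanSpace ℝ (Fin 3)) (2 * R), ‖U x‖ ^ 2
      ≤ M ^ 2 * ((2 * R) ^ 3 * V₁) :=
    setIntegral_closedBall_le_of_abs_le h2R fun x _ => by
      rw [abs_of_nonneg (by positivity)]
      exact pow_le_pow_left₀ (norm_nonneg _) (hM x) 2
  have hJ3 : ∫ x in closedBall (0 : EuclideanSpace ℝ (Fin 3)) (2 * R), ‖U x‖ ^ 3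
      ≤ M ^ 3 * ((2 * R) ^ 3 * V₁) :=
    setIntegral_closedBall_le_of_abs_le h2R fun x _ => by
      rw [abs_of_nonneg (by positivity)]
      exact pow_le_pow_left₀ (norm_nonneg _) (hM x) 3
  have hJP : ∫ x in closedBall (0 : EuclideanSpace ℝ (Fin 3)) (2 * R), |P x| * ‖U x‖
      ≤ C' * (2 * t) ^ N * M * ((2 * R) ^ 3 * V₁) :=
    setIntegral_closedBall_le_of_abs_le h2R fun x hx => by
      rw [mem_closedBall_zero_iff] at hx
      rw [abs_of_nonneg (by positivity)]
      have h1 : |P x| ≤ C' * (2 * t) ^ N := by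
        refine (hC' x).trans (mul_le_mul_of_nonneg_left ?_ hC'0)
        exact pow_le_pow_left₀ (by positivity) (by linarith) N
      exact mul_le_mul h1 (hM x) (norm_nonneg _) (by positivity)
  -- the coefficients at `x₀ = 0`, `R ≥ 1`
  have hcoefA : ν * C₂ / (2 * R ^ 2) + a / 2 + (a + ‖B‖) * C₁ * (2 * R) / (2 * R) ≤ A := by
    have e1 : ν * C₂ / (2 * R ^ 2) ≤ ν * C₂ / 2 := by
      apply div_le_div_of_nonneg_left (by positivity) (by norm_num)
      nlinarith
    have e2 : (a + ‖B‖) * C₁ * (2 * R) / (2 * R) = (a + ‖B‖) * C₁ := by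
      field_simp
    rw [e2, hA]
    linarith
  have hcoef2 : C₁ / (2 * R) ≤ C₁ := div_le_self hC₁0 (by linarith)
  have hcoef3 : C₁ / R ≤ C₁ := div_le_self hC₁0 hR
  -- nonnegativity of the local integrals
  have hJ2n : 0 ≤ ∫ x in closedBall (0 : EuclideanSpace ℝ (Fin 3)) (2 * R), ‖U x‖ ^ 2 :=
    integral_nonneg fun x => by positivity
  have hJ3n : 0 ≤ ∫ x in closedBall (0 : EuclideanSpace ℝ (Fin 3)) (2 * R), ‖U x‖ ^ 3 :=
    integral_nonneg fun x => by positivity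
  have hJPn : 0 ≤ ∫ x in closedBall (0 : EuclideanSpace ℝ (Fin 3)) (2 * R), |P x| * ‖U x‖ :=
    integral_nonneg fun x => by positivity
  -- powers of `t`
  have hR3 : (2 * R) ^ 3 ≤ 8 * t ^ 3 := by
    rw [mul_pow]; norm_num; exact pow_le_pow_left₀ hR0.le hRt 3
  have ht3 : t ^ 3 ≤ t ^ (N + 3) := pow_le_pow_right₀ ht1 (by omega)
  have htN3 : (2 * t) ^ N * t ^ 3 = 2 ^ N * t ^ (N + 3) := by rw [mul_pow, pow_add]; ring
  -- term by term
  have T1 : (ν * C₂ / (2 * R ^ 2) + a / 2 + (a + ‖B‖) * C₁ * (2 * R) / (2 * R))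
      * (∫ x in closedBall (0 : EuclideanSpace ℝ (Fin 3)) (2 * R), ‖U x‖ ^ 2)
      ≤ A * (M ^ 2 * (8 * t ^ (N + 3) * V₁)) := by
    refine mul_le_mul hcoefA (hJ2.trans ?_) hJ2n hA0
    gcongr
    exact hR3.trans (by nlinarith)
  have T2 : C₁ / (2 * R) * (∫ x in closedBall (0 : EuclideanSpace ℝ (Fin 3)) (2 * R), ‖U x‖ ^ 3)
      ≤ C₁ * (M ^ 3 * (8 * t ^ (N + 3) * V₁)) := by
    refine mul_le_mul hcoef2 (hJ3.trans ?_) hJ3n hC₁0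
    gcongr
    exact hR3.trans (by nlinarith)
  have T3 : C₁ / R * (∫ x in closedBall (0 : EuclideanSpace ℝ (Fin 3)) (2 * R), |P x| * ‖U x‖)
      ≤ C₁ * (C' * 2 ^ N * M * (8 * t ^ (N + 3) * V₁)) := by
    refine mul_le_mul hcoef3 (hJP.trans ?_) hJPn hC₁0
    have : C' * (2 * t) ^ N * M * ((2 * R) ^ 3 * V₁) ≤ C' * (2 * t) ^ N * M * (8 * t ^ 3 * V₁) := by
      gcongr
    refine this.trans (le_of_eq ?_)
    calc C' * (2 * t) ^ N * M * (8 * t ^ 3 * V₁) = C' * M * 8 * V₁ * ((2 * t) ^ N * t ^ 3) := by ring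
      _ = C' * M * 8 * V₁ * (2 ^ N * t ^ (N + 3)) := by rw [htN3]
      _ = C' * 2 ^ N * M * (8 * t ^ (N + 3) * V₁) := by ring
  have hsum := h31.trans (add_le_add (add_le_add T1 T2) T3)
  have key : ∫ x in ball (0 : EuclideanSpace ℝ (Fin 3)) R, frobeniusNormSq (fderiv ℝ U x)
      ≤ (A * (M ^ 2 * (8 * t ^ (N + 3) * V₁)) + C₁ * (M ^ 3 * (8 * t ^ (N + 3) * V₁))
          + C₁ * (C' * 2 ^ N * M * (8 * t ^ (N + 3) * V₁))) / ν := by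
    rw [le_div_iff₀ hν]
    linarith
  refine key.trans (le_of_eq ?_)
  field_simp

/-- **The squared Coriolis defect is controlled by the gradient**: for continuous linear `B, L` on
`ℝ³`, `(Σₗ (B (L eₗ))ₗ)² ≤ 3 ‖B‖² |L|²` (`|L|²` the Frobenius norm `frobeniusNormSq`), by
Cauchy–Schwarz over the three coordinates and `|(Bv)ₗ| ≤ ‖B‖ ‖v‖`. [folklore] -/
theorem sq_sum_clm_apply_le (B L : EuclideanSpace ℝ (Fin 3) →L[ℝ] EuclideanSpace ℝ (Fin 3)) :
    (∑ l, (B (L (EuclideanSpace.single l 1))) l) ^ 2 ≤ 3 * ‖B‖ ^ 2 * frobeniusNormSq L := by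
  have h1 : (∑ l, (B (L (EuclideanSpace.single l 1))) l) ^ 2
      ≤ 3 * ∑ l, ((B (L (EuclideanSpace.single l 1))) l) ^ 2 := by
    have := sq_sum_le_card_mul_sum_sq (s := (Finset.univ : Finset (Fin 3)))
      (f := fun l : Fin 3 => (B (L (EuclideanSpace.single l 1))) l)
    simpa using this
  have h2 : ∀ l : Fin 3, ((B (L (EuclideanSpace.single l 1))) l) ^ 2
      ≤ ‖B‖ ^ 2 * ‖L (EuclideanSpace.single l 1)‖ ^ 2 := fun l => by
    have e1 : |(B (L (EuclideanSpace.single l 1))) l| ≤ ‖B (L (EuclideanSpace.single l 1))‖ := by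
      have := PiLp.norm_apply_le (B (L (EuclideanSpace.single l 1))) l
      rwa [Real.norm_eq_abs] at this
    have e3 := e1.trans (B.le_opNorm _)
    calc ((B (L (EuclideanSpace.single l 1))) l) ^ 2 = |(B (L (EuclideanSpace.single l 1))) l| ^ 2 :=
          (sq_abs _).symm
      _ ≤ (‖B‖ * ‖L (EuclideanSpace.single l 1)‖) ^ 2 := pow_le_pow_left₀ (abs_nonneg _) e3 2
      _ = ‖B‖ ^ 2 * ‖L (EuclideanSpace.single l 1)‖ ^ 2 := by ring
  have h3 : frobeniusNormSq L = ∑ l : Fin 3, ‖L (EuclideanSpace.single l 1)‖ ^ 2 := by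
    rw [frobeniusNormSq_eq_sum (EuclideanSpace.basisFun (Fin 3) ℝ)]
    simp
  rw [h3, Finset.mul_sum]
  refine h1.trans ?_
  rw [Finset.mul_sum]
  exact Finset.sum_le_sum fun l _ => by nlinarith [h2 l]

/-- **Mean-square growth of the spin vorticity** `ω_β = −Σₗ (B ∂ₗU)ₗ = −tr(B∘DU)` of a smooth bounded
rotated profile: `∫_{B(0,R)} ω_β² ≤ K (1 + R)^m` for `R ≥ 1`. [cite: Tsai1998, Lemma 3.1 (3.1) (p. 37)] -/
theorem exists_integral_ball_sq_spinVorticity_le_of_rotated (hν : 0 < ν) (ha : 0 < a)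
    (hU : ContDiff ℝ (⊤ : ℕ∞) U) (hP : ContDiff ℝ 2 P) (hB : ∀ x, ⟪B x, x⟫ = 0)
    (hdiv : VectorCalculus.IsDivFree U)
    (heq : ∀ y, -(ν • (Δ U) y) + a • U y + a • fderiv ℝ U y y + (B (U y) - fderiv ℝ U y (B y)) +
      convect U U y + gradient P y = 0)
    (hbdd : ∃ M : ℝ, ∀ y, ‖U y‖ ≤ M) :
    ∃ (K : ℝ) (m : ℕ), ∀ R : ℝ, 1 ≤ R →
      ∫ x in ball (0 : EuclideanSpace ℝ (Fin 3)) R,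
          (fun z => -(∑ l, (B (fderiv ℝ U z (EuclideanSpace.single l 1))) l)) x ^ 2
        ≤ K * (1 + R) ^ m := by
  obtain ⟨K, m, hK⟩ := exists_integral_ball_frobeniusNormSq_fderiv_le_of_rotated hν ha hU hP hB hdiv heq hbdd
  refine ⟨3 * ‖B‖ ^ 2 * K, m, fun R hR => ?_⟩
  have hR0 : 0 < R := by linarith
  have hDUc : Continuous fun x => frobeniusNormSq (fderiv ℝ U x) :=
    continuous_frobeniusNormSq_fderiv (hU.of_le (by norm_cast)) two_ne_zero
  have hint : IntegrableOn (fun x => 3 * ‖B‖ ^ 2 * frobeniusNormSq (fderiv ℝ U x))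
      (ball (0 : EuclideanSpace ℝ (Fin 3)) R) :=
    ((continuous_const.mul hDUc).continuousOn.integrableOn_compact (isCompact_closedBall _ _)).mono_set
      ball_subset_closedBall
  have hωc : Continuous fun x => (-(∑ l, (B (fderiv ℝ U x (EuclideanSpace.single l 1))) l)) ^ 2 := by
    refine (continuous_finsetSum _ fun l _ => ?_).neg.pow 2
    have hU1 : ContDiff ℝ 1 U := hU.of_le (by norm_cast)
    have hD : Continuous (fderiv ℝ U) := hU1.continuous_fderiv one_ne_zero
    exact (continuous_apply l |>.comp (PiLp.continuous_ofLp 2 _)).comp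
      (B.continuous.comp (hD.clm_apply continuous_const))
  have hωint : IntegrableOn (fun x => (-(∑ l, (B (fderiv ℝ U x (EuclideanSpace.single l 1))) l)) ^ 2)
      (ball (0 : EuclideanSpace ℝ (Fin 3)) R) :=
    (hωc.continuousOn.integrableOn_compact (isCompact_closedBall _ _)).mono_set ball_subset_closedBall
  calc ∫ x in ball (0 : EuclideanSpace ℝ (Fin 3)) R,
          (fun z => -(∑ l, (B (fderiv ℝ U z (EuclideanSpace.single l 1))) l)) x ^ 2
      ≤ ∫ x in ball (0 : EuclideanSpace ℝ (Fin 3)) R, 3 * ‖B‖ ^ 2 * frobeniusNormSq (fderiv ℝ U x) := by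
        refine setIntegral_mono hωint hint fun x => ?_
        show (-(∑ l, (B (fderiv ℝ U x (EuclideanSpace.single l 1))) l)) ^ 2 ≤ _
        rw [neg_sq]
        exact sq_sum_clm_apply_le B (fderiv ℝ U x)
    _ = 3 * ‖B‖ ^ 2 * ∫ x in ball (0 : EuclideanSpace ℝ (Fin 3)) R, frobeniusNormSq (fderiv ℝ U x) :=
        integral_const_mul _ _
    _ ≤ 3 * ‖B‖ ^ 2 * (K * (1 + R) ^ m) := mul_le_mul_of_nonneg_left (hK R hR) (by positivity)
    _ = 3 * ‖B‖ ^ 2 * K * (1 + R) ^ m := by ring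

end MeanSquare

end Summit.NavierStokesRegularity.NavierStokesRegularity.Theorems.CoriolisHead

end
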